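import Summits.BirchSwinnertonDyer.Rank1Residual.GaloisImage.FiniteSingularComparisonAlgebra
import Summits.BirchSwinnertonDyer.Rank1Residual.X11b.MaxUnramifiedRestriction
import Literature.NumberTheory.GaloisRepresentations.GaloisRepUnramifiedProofs
import Mathlib.RingTheory.RootsOfUnity.PrimitiveRoots
import HarnessLib

/-!
# The canonical finite–singular comparison map, II: existence of `φ^{fs}` (Rubin Def. 1.9.6 in
# Kim's generator-fixed form) — local statement, and the Kolyvagin datum over a number field
# (cell `b2b-bsdres`, team n1011, seat p04 gen 4, OWNERS row T-HCC; file 2/3)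

HONEST FRAMING (cell `b2b-bsdres`, run/shared/lean/b2b/bsd-rank1-residual/, verbatim in every
file): the goal of the cell is to DELETE the COMBINATION-SHAPED residual classes of the
Birch–Swinnerton-Dyer formula for ALL analytic-rank `≤ 1` elliptic curves over `ℚ` — "full BSD
formula for every rank `≤ 1` curve in class `C`" assembled STRICTLY from published theorems — so
that the rank-`≤ 1` remainder becomes exactly the CONSTRUCTION-SHAPED classes, which are TYPED
(missing-input `Prop`s), NOT attempted. This is not "finishing BSD". Team n1011 (N10 / N11, the
additive block X4 ∧ `p = 3`): research route on the CONSTRUCTION-SHAPED class X4; no claim beyond the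
stated classes; nothing is booked. Theorems only (no definition, no named fact, no `sorry`).

## What is proved

* `FSComp.exists_isFiniteSingularComparisonWith` (local): for a non-archimedean local field `F`,
  a discrete `Γ_F`-module `M` free of finite rank over `ℤ/N` (`N ≥ 1`) on which the inertia group
  `I_F` acts trivially and with `P(1) = det(1 − φ | M) = 0` for the arithmetic Frobenii `φ`, a
  locally constant character `χ : Γ_F → Rˣ` (intended: the mod `ℓ` cyclotomic character of
  `Γ_{ℚ_ℓ}`, `R = ℤ/ℓ`) and a generator `η` of `Rˣ` with `N ∣ ord η` (a primitive root mod `ℓ`;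
  `N ∣ ℓ − 1`), THERE IS a homomorphism `fs : H¹(F, M) → H¹(F, M)/H¹_ur(F, M)` such that
  `IsFiniteSingularComparisonWith ρ N fs φ τ` (tree predicate, `FiniteSingularComparison.lean`)
  holds for EVERY arithmetic Frobenius `φ` and EVERY `τ ∈ I_F` with `χ(τ) = η`.  The map is
  Rubin's composite written on cocycles: `[z] ↦ [t_a] mod H¹_ur`, `a = Q(φ⁻¹)·z(φ) ∈ M^{Γ_F}`,
  `t_a(g) = log_η χ(g) • a` (the inflated homomorphism `σ_η ↦ a`).
* `FSComp.exists_kolyvaginDatum_hasCanonicalComparison` (global, any number field `K`, any prime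
  set `𝒫`, any transverse conditions `𝒯`): if at every `𝔮 ∈ 𝒫` the module is unramified, `η_𝔮`
  generates `(ℤ/N𝔮)ˣ` with `N ∣ ord η_𝔮`, and `P(1) = 0` at the arithmetic Frobenii, then
  `∃ D : KolyvaginDatum ρ, D.primes = 𝒫 ∧ D.transverse = 𝒯 ∧ D.HasCanonicalComparison N η` — the
  binder `hD` of the tree's Sakamoto fact and of
  `GaloisImage.kolyvaginSystems_freeRankOne_propagatedSelmerStructure` (n1011-p13) DISCHARGED by
  construction.  The `K = ℚ` instance at Sakamoto's `frobeniusClassPrimes` (where the remaining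
  binders follow from `τ ∈ Gal(ℚ̄/ℚ(μ_N))` and `T/(τ − 1)T ≅ ℤ/N`) is file 3/3,
  `GaloisImage/CanonicalKolyvaginDatum`.

Ingredients: §4 the generator-fixed discrete logarithm `log_η : Rˣ → ℤ/N` (Mathlib
`IsPrimitiveRoot.zmodEquivZPowers`) and local constancy of characters trivial near `1`; §5 the
transverse cocycles `a ↦ t_a` (additive on `M^{Γ_F}`) and the evaluation map `z ↦ Q(φ⁻¹) z(φ)`
(additive, valued in `M^{Γ_F}` by file I, killing principal cocycles by Cayley–Hamilton); §6
descent of an additive map on cocycles killing the principal ones to `H¹`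
(`oneCocycleClass_surjective` / `_eq_zero_iff`); §7 the assembly, using file I for the
independence of the Frobenius and X11b's `LocBridge.mem_unramifiedSubgroup_one_iff_forall_eq_zero`
("unramified class ⟺ cocycle vanishes on `I_F`", imported BY NAME) twice — for the unramified
input class and for `[w] − [t_a]`; §8 the global datum (`fs = 0` off `𝒫`; the local cyclotomic
character `localNormCyclotomicCharacter 𝔮` is locally constant by the tree's
`modNCyclotomicCharacter_eventually_eq_one`; unramified global ⟹ local by
`GaloisRep.isUnramifiedAt_iff_toLocal_holds`).

Not claimed here (not part of the predicate): that the values are TRANSVERSE classes (Rubin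
Prop. 1.9.5) and that `φ^{fs}` is a bijection `H¹_ur ⥲ H¹/H¹_ur` (Rubin Ex. 1.9.7 = Mazur–Rubin
Lemma 1.2.3, the `IsAdmissible` property).

References: K. Rubin, *Euler systems and Kolyvagin systems*, IAS/Park City Math. Ser. 18 (2011),
Def. 1.9.4, Prop. 1.9.5 (1)–(2), Def. 1.9.6 (p. 14); B. Mazur, K. Rubin, Mem. AMS 799 (2004),
Def. 1.2.2; C.-H. Kim, Amer. J. Math. 148 (2026) §2.1.2 (the display defining `φ^{fs}_ℓ`), §2.2.2
("the choice of generators of `Gal(ℚ(μ_ℓ)/ℚ)` … corresponds to the choice of the primitive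
roots"); R. Sakamoto, JTNB 36 (2024) §4.
-/

noncomputable section

open Field Polynomial
open Literature.NumberTheory.GaloisRepresentations
open Literature.NumberTheory.GaloisRepresentations.DiscreteGaloisModule
open scoped ContRepresentation Polynomial

universe u

namespace Summit.BirchSwinnertonDyer.Rank1Residual.GaloisImage

namespace FSComp

/-! ### §4 The generator-fixed discrete logarithm and locally constant characters -/

section DLog

/-- **Discrete logarithm to base a generator `η`, modulo `N ∣ ord η`**: an additive
`λ : Rˣ → ℤ/N` with `λ(uv) = λ u + λ v` and `λ η = 1` (Mathlib `IsPrimitiveRoot.zmodEquivZPowers`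
composed with `ZMod.castHom`). For `R = ℤ/ℓ`, `η` a primitive root mod `ℓ`: Kim's "choice of the
primitive roots", §2.2.2. [folklore] -/
theorem exists_dlog {R : Type*} [CommRing R] (η : Rˣ)
    (hgen : Subgroup.zpowers η = ⊤) (N : ℕ) (hN : N ∣ orderOf η) :
    ∃ lam : Rˣ → ZMod N, (∀ u v, lam (u * v) = lam u + lam v) ∧ lam η = 1 := by
  have hprim : IsPrimitiveRoot η (orderOf η) := IsPrimitiveRoot.orderOf η
  have hmem : ∀ u : Rˣ, u ∈ Subgroup.zpowers η := fun u => by rw [hgen]; exact Subgroup.mem_top u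
  refine ⟨fun u => ZMod.castHom hN (ZMod N)
      (hprim.zmodEquivZPowers.symm (Additive.ofMul (⟨u, hmem u⟩ : Subgroup.zpowers η))),
    fun u v => ?_, ?_⟩
  · rw [← map_add, ← map_add]
    rfl
  · have h1 : hprim.zmodEquivZPowers ((1 : ℕ) : ZMod (orderOf η)) =
        Additive.ofMul (⟨η, hmem η⟩ : Subgroup.zpowers η) := by
      rw [hprim.zmodEquivZPowers_apply_coe_nat]
      congr 1
      exact Subtype.ext (pow_one η)
    change ZMod.castHom hN (ZMod N)
      (hprim.zmodEquivZPowers.symm (Additive.ofMul (⟨η, hmem η⟩ : Subgroup.zpowers η))) = 1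
    rw [← h1, AddEquiv.symm_apply_apply, Nat.cast_one, map_one]

/-- A homomorphism out of a topological group which is `1` near `1` is locally constant
(`𝓝 g = g · 𝓝 1`). [folklore] -/
theorem isLocallyConstant_of_eventually_eq_one {G : Type*} [Group G] [TopologicalSpace G]
    [IsTopologicalGroup G] {C : Type*} [MulOneClass C] {H : Type*} [FunLike H G C]
    [MonoidHomClass H G C] (χ : H) (h : ∀ᶠ σ in nhds (1 : G), χ σ = 1) :
    IsLocallyConstant (χ : G → C) := by
  refine (IsLocallyConstant.iff_eventually_eq (χ : G → C)).mpr fun g => ?_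
  rw [← map_mul_left_nhds_one g, Filter.eventually_map]
  exact h.mono fun σ hσ => by rw [map_mul, hσ, mul_one]

end DLog

/-! ### §5 The transverse cocycles `t_a = λ(·) • a` and the evaluation map `z ↦ Q(φ⁻¹) z(φ)` -/

section Cocycles

variable {F : Type u} [Field F] [ValuativeRel F] [TopologicalSpace F] [IsNonarchimedeanLocalField F]
variable {M : Type u} [AddCommGroup M] [TopologicalSpace M] [DiscreteTopology M]
variable (ρ : DiscreteGaloisModule F M) (N : ℕ) [NeZero N] [Module (ZMod N) M]

omit [ValuativeRel F] [TopologicalSpace F] [IsNonarchimedeanLocalField F] in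
/-- A `ℤ/N`-multiple of a `Γ_F`-fixed vector is fixed (`k • a = k.val • a`). [folklore] -/
theorem apply_zmod_smul_of_forall_apply_eq {a : M}
    (ha : ∀ g : absoluteGaloisGroup F, ρ g a = a) (k : ZMod N) (g : absoluteGaloisGroup F) :
    ρ g (k • a) = k • a := by
  rw [← ZMod.natCast_zmod_val k, Nat.cast_smul_eq_nsmul, map_nsmul, ha]

omit [ValuativeRel F] [TopologicalSpace F] [IsNonarchimedeanLocalField F] in
/-- **The transverse cocycles, as an additive map `a ↦ t_a` on the fixed vectors**: for an
additive, locally constant `Λ : Γ_F → ℤ/N`, `t_a(g) = Λ(g) • a` is a continuous crossed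
homomorphism for every `Γ_F`-fixed `a` (inflation of the homomorphism `Gal(L/F) → A^{ϕ=1}`,
`σ_L ↦ a`, Rubin Prop. 1.9.5 (1)–(2)). [folklore] -/
theorem exists_transverseHom (Λ : absoluteGaloisGroup F → ZMod N)
    (hΛ : ∀ g h, Λ (g * h) = Λ g + Λ h) (hlc : IsLocallyConstant Λ) :
    ∃ T : ρ.invariants →+ contOneCocycles ρ.toTopRep,
      ∀ (a : ρ.invariants) (g : absoluteGaloisGroup F), (T a).1 g = Λ g • (a : M) := by
  have hfix : ∀ (a : ρ.invariants) (g : absoluteGaloisGroup F), ρ g (a : M) = a :=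
    fun a g => (ρ.mem_invariants (a : M)).mp a.2 g
  refine ⟨{ toFun := fun a => ⟨⟨fun g => Λ g • (a : M), (hlc.comp (· • (a : M))).continuous⟩,
              fun g h => ?_⟩
            map_zero' := ?_
            map_add' := fun a b => ?_ }, fun a g => rfl⟩
  · change Λ (g * h) • (a : M) = Λ g • (a : M) + ρ g (Λ h • (a : M))
    rw [hΛ, add_smul, apply_zmod_smul_of_forall_apply_eq ρ N (hfix a)]
  · exact Subtype.ext (ContinuousMap.ext fun g => smul_zero (Λ g))
  · exact Subtype.ext (ContinuousMap.ext fun g => smul_add (Λ g) (a : M) (b : M))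

variable [Module.Free (ZMod N) M] [Module.Finite (ZMod N) M]

/-- **The evaluation map `z ↦ Q(φ⁻¹)·z(φ)` on cocycles, valued in the fixed vectors**
(Rubin Def. 1.9.6: `H¹_u(K, A) ⥲ A/(ϕ−1)A →^{Q(ϕ⁻¹)} A^{ϕ=1}`, here on all cocycles with a fixed
Frobenius `φ`; the values are `Γ_F`-fixed by `apply_comparisonOp_of_unramified`). [folklore] -/
theorem exists_evalHom (hI : ∀ τ ∈ absInertia F, ρ τ = 1) {φ : absoluteGaloisGroup F}
    (hφ : IsAbsArithFrob φ) (h1 : (ρ.comparisonP N φ).eval 1 = 0) :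
    ∃ E : contOneCocycles ρ.toTopRep →+ ρ.invariants,
      ∀ z, (E z : M) = ρ.comparisonOp N φ (z.1 φ) := by
  refine ⟨{ toFun := fun z => ⟨ρ.comparisonOp N φ (z.1 φ), (ρ.mem_invariants _).mpr fun g =>
              apply_comparisonOp_of_unramified ρ N hI hφ h1 _ g⟩
            map_zero' := Subtype.ext ?_
            map_add' := fun z z' => Subtype.ext ?_ }, fun z => rfl⟩
  · change ρ.comparisonOp N φ ((0 : contOneCocycles ρ.toTopRep).1 φ) = 0
    rw [Submodule.coe_zero, ContinuousMap.zero_apply, map_zero]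
  · change ρ.comparisonOp N φ ((z + z').1 φ) =
      ρ.comparisonOp N φ (z.1 φ) + ρ.comparisonOp N φ (z'.1 φ)
    rw [Submodule.coe_add, ContinuousMap.add_apply, map_add]

omit [ValuativeRel F] [TopologicalSpace F] [IsNonarchimedeanLocalField F] [NeZero N] in
/-- The evaluation map kills principal cocycles: `Q(φ⁻¹)(φ v − v) = 0`. [folklore] -/
theorem evalHom_eq_zero_of_oneCocycleClass_eq_zero {φ : absoluteGaloisGroup F}
    (h1 : (ρ.comparisonP N φ).eval 1 = 0) (E : contOneCocycles ρ.toTopRep →+ ρ.invariants)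
    (hE : ∀ z, (E z : M) = ρ.comparisonOp N φ (z.1 φ)) (z : contOneCocycles ρ.toTopRep)
    (hz : oneCocycleClass ρ.toTopRep z = 0) : E z = 0 := by
  obtain ⟨v, hv⟩ := (oneCocycleClass_eq_zero_iff ρ.toTopRep z).mp hz
  apply Subtype.ext
  rw [hE, hv φ, Submodule.coe_zero]
  exact comparisonOp_apply_sub ρ N φ h1 v

end Cocycles

/-! ### §6 Descending an additive map on cocycles to `H¹` -/

section Descent

variable {F : Type u} [Field F] {M : Type u} [AddCommGroup M] [TopologicalSpace M]
  [DiscreteTopology M] (ρ : DiscreteGaloisModule F M)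

/-- An additive map on continuous crossed homomorphisms that kills the principal ones factors
through `H¹(F, M)` (`H¹ = Z¹/B¹`: `oneCocycleClass_surjective`, `oneCocycleClass_eq_zero_iff`).
[folklore] -/
theorem exists_lift_of_oneCocycles {A : Type*} [AddCommGroup A]
    (f : contOneCocycles ρ.toTopRep →+ A)
    (hf : ∀ z : contOneCocycles ρ.toTopRep, oneCocycleClass ρ.toTopRep z = 0 → f z = 0) :
    ∃ fbar : galoisCohomology ρ 1 →+ A, ∀ z, fbar (oneCocycleClass ρ.toTopRep z) = f z := by
  classical
  have hsurj : ∀ c : galoisCohomology ρ 1, ∃ z, oneCocycleClass ρ.toTopRep z = c :=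
    fun c => oneCocycleClass_surjective ρ.toTopRep c
  choose s hs using hsurj
  have key : ∀ z, f (s (oneCocycleClass ρ.toTopRep z)) = f z := fun z => by
    rw [← sub_eq_zero, ← map_sub]
    apply hf
    rw [oneCocycleClass_sub, hs, sub_self]
  refine ⟨{ toFun := fun c => f (s c), map_zero' := ?_, map_add' := fun c d => ?_ }, key⟩
  · have h0 : oneCocycleClass ρ.toTopRep (s 0) = 0 := hs 0
    exact hf _ h0
  · obtain ⟨zc, rfl⟩ := oneCocycleClass_surjective ρ.toTopRep c
    obtain ⟨zd, rfl⟩ := oneCocycleClass_surjective ρ.toTopRep d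
    change f (s (oneCocycleClass ρ.toTopRep zc + oneCocycleClass ρ.toTopRep zd)) = _
    rw [← oneCocycleClass_add, key, key, key, map_add]

end Descent

/-! ### §7 The canonical finite–singular comparison map: existence -/

section Main

variable {F : Type u} [Field F] [ValuativeRel F] [TopologicalSpace F] [IsNonarchimedeanLocalField F]
variable {M : Type u} [AddCommGroup M] [TopologicalSpace M] [DiscreteTopology M]
variable (ρ : DiscreteGaloisModule F M) (N : ℕ) [NeZero N] [Module (ZMod N) M]
  [Module.Free (ZMod N) M] [Module.Finite (ZMod N) M]

omit [TopologicalSpace F] [IsNonarchimedeanLocalField F] in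
/-- The singular part of a class is additive in the cocycle. [folklore] -/
theorem singularMap_oneCocycleClass_add (z w : contOneCocycles ρ.toTopRep) :
    ρ.singularMap (oneCocycleClass ρ.toTopRep (z + w)) =
      ρ.singularMap (oneCocycleClass ρ.toTopRep z) + ρ.singularMap (oneCocycleClass ρ.toTopRep w) := by
  rw [oneCocycleClass_add]
  exact map_add ρ.singularMap _ _

omit [TopologicalSpace F] [IsNonarchimedeanLocalField F] in
/-- The singular part of the class of the zero cocycle vanishes. [folklore] -/
theorem singularMap_oneCocycleClass_zero :
    ρ.singularMap (oneCocycleClass ρ.toTopRep 0) = 0 := by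
  rw [oneCocycleClass_zero]
  exact map_zero ρ.singularMap

omit [TopologicalSpace F] [IsNonarchimedeanLocalField F] in
/-- Two cocycles have the same singular part iff their difference is an unramified class.
[folklore] -/
theorem singularMap_oneCocycleClass_eq_iff (z w : contOneCocycles ρ.toTopRep) :
    ρ.singularMap (oneCocycleClass ρ.toTopRep z) = ρ.singularMap (oneCocycleClass ρ.toTopRep w) ↔
      oneCocycleClass ρ.toTopRep (z - w) ∈ unramifiedSubgroup ρ 1 := by
  rw [oneCocycleClass_sub]
  exact ⟨fun h => (singularMap_eq_zero_iff ρ _).mp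
      ((map_sub ρ.singularMap _ _).trans (sub_eq_zero.mpr h)),
    fun h => sub_eq_zero.mp
      ((map_sub ρ.singularMap _ _).symm.trans ((singularMap_eq_zero_iff ρ _).mpr h))⟩

/-- **Existence of the canonical finite–singular comparison map (Rubin Def. 1.9.6 / Mazur–Rubin
Def. 1.2.2, in Kim's generator-fixed form), local statement.** Let `F` be a non-archimedean local
field, `M` a free `ℤ/N`-module of finite rank with a discrete `Γ_F`-action UNRAMIFIED (`I_F` acts
trivially) and such that `P(1) = det(1 − φ | M) = 0` for the arithmetic Frobenii `φ`; let
`χ : Γ_F → Rˣ` be a locally constant character (intended: the mod `ℓ` cyclotomic character of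
`Γ_{ℚ_ℓ}`), `η ∈ Rˣ` a generator of `Rˣ` with `N ∣ ord η` (a primitive root mod `ℓ`, `N ∣ ℓ − 1`).
Then there is a homomorphism `fs : H¹(F, M) → H¹(F, M)/H¹_ur(F, M)` which IS the finite–singular
comparison map computed with EVERY arithmetic Frobenius `φ` and EVERY inertia element `τ` with
`χ(τ) = η` (`IsFiniteSingularComparisonWith`): `fs [z] = [t_a] mod H¹_ur`, `a = Q(φ⁻¹) z(φ)`,
`t_a(g) = log_η χ(g) • a`. Rubin, PCMI 18 (2011) Def. 1.9.6 with Prop. 1.4.13 (1), 1.9.5 (1)–(2);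
Kim, AJM 148 §2.1.2, §2.2.2. [folklore] -/
theorem exists_isFiniteSingularComparisonWith (hI : ∀ τ ∈ absInertia F, ρ τ = 1)
    (hP : ∀ φ : absoluteGaloisGroup F, IsAbsArithFrob φ → (ρ.comparisonP N φ).eval 1 = 0)
    {R : Type*} [CommRing R] (χ : absoluteGaloisGroup F →* Rˣ) (hχ : IsLocallyConstant χ)
    (η : Rˣ) (hgen : Subgroup.zpowers η = ⊤) (hN : N ∣ orderOf η) :
    ∃ fs : galoisCohomology ρ 1 →+ ρ.SingularQuotient,
      ∀ φ τ : absoluteGaloisGroup F, IsAbsArithFrob φ → τ ∈ absInertia F → χ τ = η →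
        ρ.IsFiniteSingularComparisonWith N fs φ τ := by
  have hI' : ∀ τ ∈ absInertia F, ∀ w : M, ρ τ w = w := fun τ hτ w => by
    rw [hI τ hτ, Module.End.one_apply]
  -- a fixed arithmetic Frobenius
  obtain ⟨φ₀, hφ₀⟩ := exists_isAbsArithFrob_holds (F := F)
  -- the generator-fixed logarithm `Λ = log_η ∘ χ : Γ_F → ℤ/N`
  obtain ⟨lam, hlam, hlam1⟩ := exists_dlog η hgen N hN
  have hΛ : ∀ g h, lam (χ (g * h)) = lam (χ g) + lam (χ h) := fun g h => by rw [map_mul, hlam]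
  have hΛlc : IsLocallyConstant (fun g => lam (χ g)) := hχ.comp lam
  -- the pieces
  obtain ⟨T, hT⟩ := exists_transverseHom ρ N (fun g => lam (χ g)) hΛ hΛlc
  obtain ⟨E, hE⟩ := exists_evalHom ρ N hI hφ₀ (hP φ₀ hφ₀)
  let f : contOneCocycles ρ.toTopRep →+ ρ.SingularQuotient :=
    AddMonoidHom.mk' (fun z => ρ.singularMap (oneCocycleClass ρ.toTopRep (T (E z))))
      (fun z z' => by rw [map_add, map_add, singularMap_oneCocycleClass_add])
  have hf : ∀ z, f z = ρ.singularMap (oneCocycleClass ρ.toTopRep (T (E z))) := fun z => rfl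
  obtain ⟨fs, hfs⟩ := exists_lift_of_oneCocycles ρ f (fun z hz => by
    rw [hf, evalHom_eq_zero_of_oneCocycleClass_eq_zero ρ N (hP φ₀ hφ₀) E hE z hz, map_zero,
      singularMap_oneCocycleClass_zero])
  refine ⟨fs, fun φ τ hφ hτ hχτ => ⟨hP φ hφ, fun z w hz hw => ?_⟩⟩
  -- `z` vanishes on inertia; `a = Q(φ₀⁻¹) z(φ₀) = Q(φ⁻¹) z(φ)`
  have hz' : ∀ τ ∈ absInertia F, z.1 τ = 0 :=
    (X11b.LocBridge.mem_unramifiedSubgroup_one_iff_forall_eq_zero ρ hI' z).mp hz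
  have ha : (E z : M) = ρ.comparisonOp N φ (z.1 φ) := by
    rw [hE, comparisonOp_eq_of_isAbsArithFrob ρ N hI hφ₀ hφ,
      cocycle_apply_eq_of_isAbsArithFrob ρ hI z hz' hφ₀ hφ]
  -- `[w] - [t_a]` is unramified, so `w - t_a` vanishes on inertia
  rw [hfs, hf, singularMap_oneCocycleClass_eq_iff] at hw
  have hvan := (X11b.LocBridge.mem_unramifiedSubgroup_one_iff_forall_eq_zero ρ hI' _).mp hw τ hτ
  rw [Submodule.coe_sub, ContinuousMap.sub_apply, sub_eq_zero, hT, hχτ, hlam1, one_smul] at hvan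
  rw [hvan, ha]

end Main


/-! ### §8 Global: a Kolyvagin datum with THE canonical comparison maps over a number field -/

section Global

open NumberField IsDedekindDomain
open Literature.NumberTheory.GaloisCohomology
open scoped NumberField

variable {K : Type u} [Field K] [NumberField K]
variable {M : Type u} [AddCommGroup M] [TopologicalSpace M] [DiscreteTopology M]

/-- The mod `N𝔮` cyclotomic character of `Γ_{K_𝔮}` (`localNormCyclotomicCharacter`) is locally
constant: it is the global mod `N𝔮` character (locally constant, tree
`modNCyclotomicCharacter_eventually_eq_one`) pulled back along the continuous `Γ_{K_𝔮} → Γ_K`.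
[folklore] -/
theorem isLocallyConstant_localNormCyclotomicCharacter (q : HeightOneSpectrum (𝓞 K)) :
    IsLocallyConstant (localNormCyclotomicCharacter q) := by
  apply isLocallyConstant_of_eventually_eq_one
  have h := modNCyclotomicCharacter_eventually_eq_one K (Ideal.absNorm q.asIdeal)
  have ht : Filter.Tendsto (absGaloisRestrict K (q.adicCompletion K)) (nhds 1) (nhds 1) := by
    have hc : Continuous (absGaloisRestrict K (q.adicCompletion K) :
        absoluteGaloisGroup (q.adicCompletion K) → absoluteGaloisGroup K) := map_continuous _
    have h1 := hc.tendsto 1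
    rwa [map_one] at h1
  exact (ht.eventually h).mono fun σ hσ => by rw [localNormCyclotomicCharacter_apply]; exact hσ

/-- **A Kolyvagin datum with THE canonical finite–singular comparison maps exists** (any number
field `K`, any prime set `𝒫`, any transverse conditions): if at every `𝔮 ∈ 𝒫` the module `M`
(free of finite rank over `ℤ/N`) is unramified, `η_𝔮` generates `(ℤ/N𝔮)ˣ` with `N ∣ ord η_𝔮`
(`= N ∣ ℓ − 1` over `ℚ`), and `P(1) = det(1 − Frob_𝔮 | M) = 0`, then there is `D : KolyvaginDatum ρ`
with `D.primes = 𝒫`, `D.transverse = 𝒯` and `D.HasCanonicalComparison N η` — the binder of the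
tree's Sakamoto fact / of `GaloisImage.kolyvaginSystems_freeRankOne_propagatedSelmerStructure`
DISCHARGED by construction (Rubin Def. 1.9.6 at every `𝔮 ∈ 𝒫`, `fs = 0` off `𝒫`).
Rubin, PCMI 18 (2011) Def. 1.9.6; Kim, AJM 148 §2.1.2, §2.2.2; Sakamoto, JTNB 36 (2024) §4.
[folklore] -/
theorem exists_kolyvaginDatum_hasCanonicalComparison (ρ : DiscreteGaloisModule K M) (N : ℕ)
    [NeZero N] [Module (ZMod N) M] [Module.Free (ZMod N) M] [Module.Finite (ZMod N) M]
    (P : Set (HeightOneSpectrum (𝓞 K))) (T : SelmerStructure ρ)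
    (η : (q : HeightOneSpectrum (𝓞 K)) → (ZMod (Ideal.absNorm q.asIdeal))ˣ)
    (hη : ∀ q ∈ P, Subgroup.zpowers (η q) = ⊤) (hN : ∀ q ∈ P, N ∣ orderOf (η q))
    (hunr : ∀ q ∈ P, GaloisRep.IsUnramifiedAt q ρ)
    (hP1 : ∀ q ∈ P, ∀ φ : absoluteGaloisGroup (q.adicCompletion K), IsAbsArithFrob φ →
      (comparisonP (GaloisRep.toLocal q ρ) N φ).eval 1 = 0) :
    ∃ D : KolyvaginDatum ρ, D.primes = P ∧ D.transverse = T ∧ D.HasCanonicalComparison N η := by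
  classical
  have hloc : ∀ q ∈ P, ∃ fs : galoisCohomology (GaloisRep.toLocal q ρ) 1 →+
      SingularQuotient (GaloisRep.toLocal q ρ),
      ∀ φ τ : absoluteGaloisGroup (q.adicCompletion K), IsAbsArithFrob φ →
        τ ∈ absInertia (q.adicCompletion K) → localNormCyclotomicCharacter q τ = η q →
          IsFiniteSingularComparisonWith (GaloisRep.toLocal q ρ) N fs φ τ := fun q hq =>
    exists_isFiniteSingularComparisonWith (GaloisRep.toLocal q ρ) N
      ((GaloisRep.isUnramifiedAt_iff_toLocal_holds q ρ).mp (hunr q hq)) (hP1 q hq)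
      (localNormCyclotomicCharacter q) (isLocallyConstant_localNormCyclotomicCharacter q) (η q)
      (hη q hq) (hN q hq)
  choose fs hfs using hloc
  refine ⟨⟨P, T, fun q => if hq : q ∈ P then fs q hq else 0⟩, rfl, rfl, fun q hq => ⟨hη q hq, ?_⟩⟩
  intro φ τ hφ hτ hχ
  simp only [dif_pos hq]
  exact hfs q hq φ τ hφ hτ hχ

end Global

end FSComp

end Summit.BirchSwinnertonDyer.Rank1Residual.GaloisImage

end
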